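/- Copyright: the b2b-balaban cell (near-miss cell 7), T⁴-continuum fan-out; row NE7b OWNER lineage `t4-ne7b-p1`
(gen 60) — «G-56-1 ON THE COUNT SIDE: HULL-JOINS ARE BOOKED», part 2 of 2 (kernel item of RULING R-OWNER-60-3).
Released under the licence of the surrounding project. -/
import Summits.QuantumFields.BalabanUV.T4Continuum.Support.HistoryHullTransport
import Summits.QuantumFields.BalabanUV.T4Continuum.Support.HistoryReadinessChainRealiseWeak
import Summits.QuantumFields.BalabanUV.T4Continuum.Support.HistoryRealiseWeak

/-!
# Realised histories whose joins are made THROUGH THE HULLS (print's rectangular-parallelepiped rule) stop strictly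
inside the booked windows `dictW`, on the tree clock and on the chain clock, memory-agnostically — the rider G-56-1
«no hull in the process» is census-neutral for the COUNT, with the SAME letters (row NE7b, R-OWNER-60-3, part 2 of 2;
part 1 = `HistoryHullTransport`)

Summits-side support leaf of the T⁴-continuum cell (rung (B)+1 on a FINITE torus only; NOT infinite volume, NOT the
mass gap, NOT the Clay statement; NOT a proof of the spine estimate NE7b — the cell's OWN estimate, NOT PRINTED, NOT
PROVED).  [folklore] finite combinatorics in the ℤᵈ INDEX MODEL over part 1, repair R-41-a's `HistoryRealiseWeak`
(tree clock, memory-agnostic) and the owner's g60 chain-clock files (`HistoryReadinessChainRealise*`); no `[cite:]`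
tag, no `Prop` fact of Bałaban's minted (the two `def`s are PREDICATES with parameters — `RealisesW` ∕ `RealisesCW` with
the join contact read through bounding boxes), zero `sorry`.  [III] = [Balaban1988Convergent] pp. 251 ∕ 269 and B16 =
[Balaban1989LargeFieldII] pp. 384–387 are manuscripts UNDER AUDIT and appear only as LOCATORS.

WHY (located rider G-56-1, WALL §3 (h): print hulls every (i)-small component to its bounding box at every step, [III]
p. 269 l. 8–11; the cell's process does not; g59 §7 sized the effect — print's bbox-contact can precede the tree's raw
contact by a small catch-up count δ — and left it «information-grade, removed exactly by a hull twin of the orbit map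
(R-56-a-sized blast radius), ON ASK»).  For the COUNT the question is the same as for (d2′) (R-OWNER-60-1): are the
histories of a process that joins lines WHEN THEIR HULLS TOUCH inside the booked lifetimes `dictW`?  THIS FILE answers
yes, with the letters of record, WITHOUT a process twin: the realisation predicates of record are re-read with the join
contact clause «∃ a ∈ bbox (image of X), ∃ c ∈ bbox (image of Y), Touch a c» (weaker than the raw clause — every
raw-contact history is a hull-contact history, `realisesWH_of_realisesW` ∕ `realisesCWH_of_realisesCW` — and more
permissive than print, which hulls only (i)-small components: harmless for a booking), on BOTH clocks in their
memory-agnostic, print-exact-pendency forms (`HistoryRealiseWeak.RealisesW` → `RealisesWH`;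
`HistoryReadinessChainRealiseWeak.RealisesCW` → `RealisesCWH`), and the lifetime theorems are re-proved VERBATIM with
part 1's hull-contact join bounds (`stopAt_join_hull` ∕ `stopAt_union_hull` ∕ `stopAtC_join_hull`: the enlarged
partners `X ∪ {a}`, `Y ∪ {c}` touch RAW and keep condition (i) wherever `X`, `Y` have it, because the flow transports
bounding boxes).  Births and renewals read no contact.  Net with R-41-a and R-OWNER-60-1: the COUNT's booking `dictW`
(`L ≥ 4`, `R ≥ 1`, `n₁ ≥ 13`) is indifferent to the clock (tree ∕ chain), to the memory convention, AND to the hull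
rule — every located schedule rider of the (ID) reading ((d2′), (d3), G-56-1) costs NOTHING in the count.

WHAT.  §1 `RealisesWH`, `realisesWH_of_realisesW`, **`exists_stop_lt_reach_WH`**, `lt_reach_of_pendingBefore_WH`,
`joinInLife_of_realisesWH`, `adm_of_realisesWH`.  §2 `RealisesCWH`, `realisesCWH_of_realisesCW`,
**`exists_stopC_lt_reach_WH`**, `lt_reach_of_pendingBeforeC_WH`, `joinInLife_of_realisesCWH`, `adm_of_realisesCWH`.
§3 sanity.

HONEST SCOPE.  Index-model combinatorics on hypothesis shapes; the process of record (`HistoryGenealogyInstantiateM`: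
raw contacts, clock `StopsM`) is NOT edited and no carrier is twinned; what is certified is that hull-contact joins are
inside `dictW` — the IDENTIFICATION side of G-56-1 (which join scale a print term carries) stays a reading, now
costless for the count like (d2′) and (d3).  Census NONE; R∕T rows by count UNCHANGED.  NE7b NOT PRINTED ∕ NOT PROVED;
spine 0∕9.  HONEST DEPENDENCY (cell): continuum YM on T⁴ ⇐ BetaPertH ∧ nine spine estimates (0/9 proved); BetaPertH ⇐
(D1) ∧ (D4) ∧ CAP+tail; G-an2-4 gates asym, D1 and NE2/3/4.  This file changes none of it.
-/

open Finset
open Literature.MathematicalPhysics.QuantumFieldTheory.Balaban1983to89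
open Literature.MathematicalPhysics.QuantumFieldTheory.Balaban1983to89.B13ScaleTransfer
open Literature.MathematicalPhysics.QuantumFieldTheory.Balaban1983to89.TreeLength
open Literature.MathematicalPhysics.QuantumFieldTheory.Balaban1983to89.B16SProfile
open Literature.MathematicalPhysics.QuantumFieldTheory.Balaban1983to89.B16StoppingRule
open Literature.MathematicalPhysics.QuantumFieldTheory.Balaban1983to89.B16MergeGeometry
open Literature.MathematicalPhysics.QuantumFieldTheory.Balaban1983to89.B16MergeHorizon
open Literature.MathematicalPhysics.QuantumFieldTheory.Balaban1983to89.B14BoxFix (bbox)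
open T4PersistenceDictionary
open Summit.QuantumFields.BalabanUV.T4Continuum.HistoryAdmissible
open Summit.QuantumFields.BalabanUV.T4Continuum.HistoryWindows
open Summit.QuantumFields.BalabanUV.T4Continuum.HistoryRealise
open Summit.QuantumFields.BalabanUV.T4Continuum.HistoryRealisePrint
open Summit.QuantumFields.BalabanUV.T4Continuum.HistoryRealiseWeak
open Summit.QuantumFields.BalabanUV.T4Continuum.HistoryReadinessChainScale
open Summit.QuantumFields.BalabanUV.T4Continuum.HistoryReadinessChainWindows
open Summit.QuantumFields.BalabanUV.T4Continuum.HistoryReadinessChainRealise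
open Summit.QuantumFields.BalabanUV.T4Continuum.HistoryReadinessChainRealisePrint
open Summit.QuantumFields.BalabanUV.T4Continuum.HistoryReadinessChainRealiseWeak
open Summit.QuantumFields.BalabanUV.T4Continuum.HistoryHullTransport

namespace Summit.QuantumFields.BalabanUV.T4Continuum.HistoryRealiseHull

noncomputable section

variable {d : ℕ}

/-! ## §1 Tree clock: `RealisesW` with hull contact -/

/-- **REALISED HISTORIES, TREE CLOCK, MEMORY-AGNOSTIC, JOINS THROUGH THE HULLS**: `HistoryRealiseWeak.RealisesW` with the
join contact read through the bounding boxes of the partners' current images (`B14BoxFix.bbox`; print's hull rule,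
[III] p. 269 as LOCATOR). [folklore] -/
def RealisesWH (L : ℕ) (s : ℕ → ℕ) (R : ℕ → ℕ) : PGen (Pt d × Finset (Pt d)) → Finset (Pt d) → Prop
  | .birth _ cls zZ, Z => zZ.2 = Z ∧ zZ.1 ∈ Z ∧ FaceConnected Z ∧ treeLen Z ≤ cls
  | .renew G h, Z => ∃ ZG, RealisesWH L s R G ZG ∧ G.lastStep < h ∧
      CondI 100 (orbit L s G.lastStep ZG (h - G.lastStep)) ∧
      (∀ k, k < h - G.lastStep → ¬ Stops L s R G.lastStep ZG k) ∧ Z = orbit L s G.lastStep ZG (h + 1 - G.lastStep)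
  | .join X Y sj, Z => ∃ ZX ZY, RealisesWH L s R X ZX ∧ RealisesWH L s R Y ZY ∧ X.lastStep ≤ sj ∧ Y.lastStep ≤ sj ∧
      PendingBefore L s R X.lastStep ZX sj ∧ PendingBefore L s R Y.lastStep ZY sj ∧
      (∃ a ∈ bbox (↑(orbit L s X.lastStep ZX (sj - X.lastStep)) : Set (Pt d)),
        ∃ c ∈ bbox (↑(orbit L s Y.lastStep ZY (sj - Y.lastStep)) : Set (Pt d)), Touch a c) ∧
      Z ⊆ orbit L s X.lastStep ZX (sj - X.lastStep) ∪ orbit L s Y.lastStep ZY (sj - Y.lastStep)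

/-- a raw-contact history is a hull-contact history (`B14BoxFix.subset_bbox`). [folklore] -/
theorem realisesWH_of_realisesW {L : ℕ} {s R : ℕ → ℕ} :
    ∀ (P : PGen (Pt d × Finset (Pt d))) (Z : Finset (Pt d)), RealisesW L s R P Z → RealisesWH L s R P Z
  | .birth _ _ _, _, h => h
  | .renew G h, Z, hP => by
      obtain ⟨ZG, hG, ht, hI, hfirst, hZ⟩ := hP
      exact ⟨ZG, realisesWH_of_realisesW G ZG hG, ht, hI, hfirst, hZ⟩
  | .join X Y sj, Z, hP => by
      obtain ⟨ZX, ZY, hX, hY, htX, htY, hpX, hpY, ⟨a, ha, c, hc, hac⟩, hZ⟩ := hP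
      exact ⟨ZX, ZY, realisesWH_of_realisesW X ZX hX, realisesWH_of_realisesW Y ZY hY, htX, htY, hpX, hpY,
        ⟨a, B14BoxFix.subset_bbox _ (Finset.mem_coe.2 ha), c, B14BoxFix.subset_bbox _ (Finset.mem_coe.2 hc), hac⟩, hZ⟩

section MainW

variable {L : ℕ} {s R : ℕ → ℕ} (hL : 4 ≤ L) (hdrop : ∀ m, DropCtl s m) (hR : ∀ t, 1 ≤ R t) {n₁ : ℕ} (hn₁ : 13 ≤ n₁)
include hL hdrop hR hn₁

/-- **MAIN THEOREM, TREE CLOCK WITH HULL CONTACT.**  Every `RealisesWH`-realised history stops at some `k ≥ 1` with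
`lastStep + k < toGen.reach (dictW R n₁)` (`L ≥ 4`, drop control, `R ≥ 1`, `n₁ ≥ 13`; `dictW` untouched) —
`HistoryRealiseWeak.exists_stop_lt_reach_W`'s proof with part 1's hull-contact join bounds. [folklore] -/
theorem exists_stop_lt_reach_WH :
    ∀ (P : PGen (Pt d × Finset (Pt d))) (Z : Finset (Pt d)), RealisesWH L s R P Z →
      ∃ k, 1 ≤ k ∧ Stops L s R P.lastStep Z k ∧ P.lastStep + k < P.toGen.reach (dictW R n₁)
  | .birth j cls zZ, Z, hRZ => exists_stop_lt_reach hL hdrop hR hn₁ (.birth j cls zZ) Z hRZ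
  | .renew G h, Z, hRZ => by
      obtain ⟨ZG, -, ht, hI, -, rfl⟩ := hRZ
      set t := G.lastStep with ht_def
      -- the renewal case reads no contact: `HistoryWindows.stopAt_restart` from condition (i) at `h − t`, verbatim as
      -- in `HistoryRealiseWeak.exists_stop_lt_reach_W`
      have hrs := stopAt_restart (show 3 ≤ L by omega) (dropCtl_from hdrop t (h - t + 1 + R (h + 1)))
        (X := orbit L s t ZG) (fun l => orbit_succ L s t ZG l) hI (hR (h + 1)) (fun _ => True)
        (fun _ _ _ => trivial) le_rfl
      refine ⟨R (h + 1), hR (h + 1), ?_, ?_⟩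
      · show StopAt 100 (R (h + 1)) (fun _ => True) (orbit L s (h + 1) (orbit L s t ZG (h + 1 - t))) (R (h + 1))
        obtain ⟨-, hI', -, hall⟩ := hrs
        have hsh : ∀ l, orbit L s (h + 1) (orbit L s t ZG (h + 1 - t)) l = orbit L s t ZG (h - t + 1 + l) := by
          intro l
          rw [show h - t + 1 + l = (h + 1 - t) + l by omega, orbit_add, show t + (h + 1 - t) = h + 1 by omega]
        refine ⟨hR (h + 1), ?_, le_rfl, fun l h1 h2 => ⟨trivial, ?_⟩⟩
        · rw [hsh]; exact hI'
        · rw [hsh]; exact (hall (h - t + 1 + l) (by omega) (by omega)).2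
      · have h1 := restart_lt_dictW R n₁ (h + 1)
        simp only [PGen.lastStep, PGen.toGen, Gen.reach_renew]
        omega
  | .join X Y sj, Z, hRZ => by
      obtain ⟨ZX, ZY, hX, hY, htX, htY, hpX, hpY, ⟨a, ha, c, hc, hac⟩, hZ⟩ := hRZ
      obtain ⟨kX, hkX1, hsX, hrX⟩ := exists_stop_lt_reach_WH X ZX hX
      obtain ⟨kY, hkY1, hsY, hrY⟩ := exists_stop_lt_reach_WH Y ZY hY
      set tX := X.lastStep
      set tY := Y.lastStep
      have hKX : sj - tX ≤ kX := by
        by_contra hlt; exact hpX.2 kX (by omega) hsX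
      have hKY : sj - tY ≤ kY := by
        by_contra hlt; exact hpY.2 kY (by omega) hsY
      have hXI : CondI 100 (Siter (ratio L fun i => s (sj + i)) (tX + kX - sj) (orbit L s tX ZX (sj - tX))) := by
        have h := hsX.condI
        rw [show kX = (sj - tX) + (tX + kX - sj) by omega, orbit_add, show tX + (sj - tX) = sj by omega] at h
        exact h
      have hYI : CondI 100 (Siter (ratio L fun i => s (sj + i)) (tY + kY - sj) (orbit L s tY ZY (sj - tY))) := by
        have h := hsY.condI
        rw [show kY = (sj - tY) + (tY + kY - sj) by omega, orbit_add, show tY + (sj - tY) = sj by omega] at h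
        exact h
      have hreach : ∀ {k K₁ K₂ : ℕ}, k ≤ max K₁ K₂ + 13 + R sj → sj + K₁ < X.toGen.reach (dictW R n₁) →
          sj + K₂ < Y.toGen.reach (dictW R n₁) →
          (PGen.join X Y sj).lastStep + k < (PGen.join X Y sj).toGen.reach (dictW R n₁) := by
        intro k K₁ K₂ hk h₁ h₂
        have h := join_lt_dictW R hn₁ sj hk h₁ h₂
        simp only [PGen.lastStep, PGen.toGen, Gen.reach_merge]
        exact h
      by_cases h1 : tX + kX - sj = 0
      · have hXI0 : CondI 100 (orbit L s tX ZX (sj - tX)) := by rw [h1] at hXI; simpa using hXI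
        have hst := stopAt_union_hull (show 2 ≤ L by omega)
          (dropCtl_from hdrop sj (max (tY + kY - sj + 6) 14 + R sj - 1)) ha hc hac hXI0 hYI (hR sj) (fun _ => True)
          (fun _ _ _ => trivial) le_rfl
        refine ⟨max (tY + kY - sj + 6) 14 + R sj - 1, by omega, ?_, hreach (K₁ := 0) (K₂ := tY + kY - sj)
          (by omega) (by omega) (by omega)⟩
        apply Stops.subset hZ
        show StopAt 100 (R sj) (fun _ => True)
          (orbit L s sj (orbit L s tX ZX (sj - tX) ∪ orbit L s tY ZY (sj - tY))) _
        exact hst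
      · by_cases h2 : tY + kY - sj = 0
        · have hYI0 : CondI 100 (orbit L s tY ZY (sj - tY)) := by rw [h2] at hYI; simpa using hYI
          have hst := stopAt_union_hull (show 2 ≤ L by omega)
            (dropCtl_from hdrop sj (max (tX + kX - sj + 6) 14 + R sj - 1)) hc ha hac.symm hYI0 hXI (hR sj)
            (fun _ => True) (fun _ _ _ => trivial) le_rfl
          refine ⟨max (tX + kX - sj + 6) 14 + R sj - 1, by omega, ?_, hreach (K₁ := tX + kX - sj) (K₂ := 0)
            (by omega) (by omega) (by omega)⟩
          apply Stops.subset hZ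
          show StopAt 100 (R sj) (fun _ => True)
            (orbit L s sj (orbit L s tX ZX (sj - tX) ∪ orbit L s tY ZY (sj - tY))) _
          rw [Finset.union_comm]
          exact hst
        · obtain ⟨k, hk1, hkle, hstop⟩ := stopAt_join_hull (show 2 ≤ L by omega)
            (dropCtl_from hdrop sj (max (tX + kX - sj) (tY + kY - sj) + 13 + R sj)) ha hc hac (by omega) (by omega)
            hXI hYI (hR sj) (fun _ => True) (fun _ _ _ => trivial) le_rfl
          refine ⟨k, hk1, ?_, hreach hkle (by omega) (by omega)⟩
          apply Stops.subset hZ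
          show StopAt 100 (R sj) (fun _ => True)
            (orbit L s sj (orbit L s tX ZX (sj - tX) ∪ orbit L s tY ZY (sj - tY))) k
          exact hstop

/-- **PENDING STRICTLY BEFORE THE CUTOFF ⇒ INSIDE THE BOOKED LIFE**, tree clock with hull contact. [folklore] -/
theorem lt_reach_of_pendingBefore_WH {P : PGen (Pt d × Finset (Pt d))} {Z : Finset (Pt d)}
    (hP : RealisesWH L s R P Z) {K : ℕ} (hK : PendingBefore L s R P.lastStep Z K) :
    K < P.toGen.reach (dictW R n₁) := by
  obtain ⟨k, -, hs, hlt⟩ := exists_stop_lt_reach_WH hL hdrop hR hn₁ P Z hP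
  have : K - P.lastStep ≤ k := by
    by_contra hlt'; exact hK.2 k (by omega) hs
  have := hK.1
  omega

/-- **`JoinInLife`, TREE CLOCK WITH HULL CONTACT.** [folklore] -/
theorem joinInLife_of_realisesWH :
    ∀ (P : PGen (Pt d × Finset (Pt d))) (Z : Finset (Pt d)), RealisesWH L s R P Z → P.JoinInLife (dictW R n₁)
  | .birth _ _ _, _, _ => trivial
  | .renew G h, Z, hP => by
      obtain ⟨ZG, hG, -, -, -, -⟩ := hP
      exact joinInLife_of_realisesWH G ZG hG
  | .join X Y sj, Z, hP => by
      obtain ⟨ZX, ZY, hX, hY, -, -, hpX, hpY, -, -⟩ := hP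
      exact ⟨joinInLife_of_realisesWH X ZX hX, joinInLife_of_realisesWH Y ZY hY,
        lt_reach_of_pendingBefore_WH hL hdrop hR hn₁ hX hpX, lt_reach_of_pendingBefore_WH hL hdrop hR hn₁ hY hpY⟩

end MainW

/-- **`Adm`, TREE CLOCK WITH HULL CONTACT.** [folklore] -/
theorem adm_of_realisesWH {L : ℕ} {s R : ℕ → ℕ} :
    ∀ (P : PGen (Pt d × Finset (Pt d))) (Z : Finset (Pt d)), RealisesWH L s R P Z →
      ∀ {K : ℕ}, P.lastStep ≤ K → P.Adm K
  | .birth _ _ _, _, _, _, hK => hK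
  | .renew G h, Z, hP, K, hK => by
      obtain ⟨ZG, hG, ht, -, -, -⟩ := hP
      simp only [PGen.lastStep] at hK
      exact ⟨adm_of_realisesWH G ZG hG (by omega), by omega, hK⟩
  | .join X Y sj, Z, hP, K, hK => by
      obtain ⟨ZX, ZY, hX, hY, htX, htY, -, -, -, -⟩ := hP
      exact ⟨adm_of_realisesWH X ZX hX (htX.trans hK), adm_of_realisesWH Y ZY hY (htY.trans hK), htX, htY, hK⟩

/-! ## §2 Chain clock: `RealisesCW` with hull contact -/

/-- **REALISED HISTORIES, CHAIN CLOCK, MEMORY-AGNOSTIC, JOINS THROUGH THE HULLS**: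
`HistoryReadinessChainRealiseWeak.RealisesCW` with the join contact read through the bounding boxes of the partners'
current images. [folklore] -/
def RealisesCWH (L : ℕ) (s : ℕ → ℕ) (R : ℕ → ℕ) : PGen (Pt d × Finset (Pt d)) → Finset (Pt d) → Prop
  | .birth _ cls zZ, Z => zZ.2 = Z ∧ zZ.1 ∈ Z ∧ FaceConnected Z ∧ treeLen Z ≤ cls
  | .renew G h, Z => ∃ ZG, RealisesCWH L s R G ZG ∧ G.lastStep < h ∧
      CondI 100 (orbit L s G.lastStep ZG (h - G.lastStep - 1)) ∧ CondI 100 (orbit L s G.lastStep ZG (h - G.lastStep)) ∧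
      (∀ k, k < h - G.lastStep → ¬ StopsC L s R G.lastStep ZG k) ∧ Z = orbit L s G.lastStep ZG (h + 1 - G.lastStep)
  | .join X Y sj, Z => ∃ ZX ZY, RealisesCWH L s R X ZX ∧ RealisesCWH L s R Y ZY ∧ X.lastStep ≤ sj ∧ Y.lastStep ≤ sj ∧
      PendingBeforeC L s R X.lastStep ZX sj ∧ PendingBeforeC L s R Y.lastStep ZY sj ∧
      (∃ a ∈ bbox (↑(orbit L s X.lastStep ZX (sj - X.lastStep)) : Set (Pt d)),
        ∃ c ∈ bbox (↑(orbit L s Y.lastStep ZY (sj - Y.lastStep)) : Set (Pt d)), Touch a c) ∧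
      Z ⊆ orbit L s X.lastStep ZX (sj - X.lastStep) ∪ orbit L s Y.lastStep ZY (sj - Y.lastStep)

/-- a raw-contact chain-clock history is a hull-contact one. [folklore] -/
theorem realisesCWH_of_realisesCW {L : ℕ} {s R : ℕ → ℕ} :
    ∀ (P : PGen (Pt d × Finset (Pt d))) (Z : Finset (Pt d)), RealisesCW L s R P Z → RealisesCWH L s R P Z
  | .birth _ _ _, _, h => h
  | .renew G h, Z, hP => by
      obtain ⟨ZG, hG, ht, h1, h2, hfirst, hZ⟩ := hP
      exact ⟨ZG, realisesCWH_of_realisesCW G ZG hG, ht, h1, h2, hfirst, hZ⟩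
  | .join X Y sj, Z, hP => by
      obtain ⟨ZX, ZY, hX, hY, htX, htY, hpX, hpY, ⟨a, ha, c, hc, hac⟩, hZ⟩ := hP
      exact ⟨ZX, ZY, realisesCWH_of_realisesCW X ZX hX, realisesCWH_of_realisesCW Y ZY hY, htX, htY, hpX, hpY,
        ⟨a, B14BoxFix.subset_bbox _ (Finset.mem_coe.2 ha), c, B14BoxFix.subset_bbox _ (Finset.mem_coe.2 hc), hac⟩, hZ⟩

section MainC

variable {L : ℕ} {s R : ℕ → ℕ} (hL : 4 ≤ L) (hdrop : ∀ m, DropCtl s m) (hR : ∀ t, 1 ≤ R t) {n₁ : ℕ} (hn₁ : 13 ≤ n₁)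
include hL hdrop hR hn₁

/-- **MAIN THEOREM, CHAIN CLOCK WITH HULL CONTACT (memory-agnostic, print-exact pendency).**  Every
`RealisesCWH`-realised history chain-stops at some `k ≥ 1` with `lastStep + k < toGen.reach (dictW R n₁)` (`L ≥ 4`,
drop control, `R ≥ 1`, `n₁ ≥ 13`; `dictW` untouched) — `HistoryReadinessChainRealiseWeak.exists_stopC_lt_reach_W`'s
proof with part 1's `stopAtC_join_hull`. [folklore] -/
theorem exists_stopC_lt_reach_WH :
    ∀ (P : PGen (Pt d × Finset (Pt d))) (Z : Finset (Pt d)), RealisesCWH L s R P Z →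
      ∃ k, 1 ≤ k ∧ StopsC L s R P.lastStep Z k ∧ P.lastStep + k < P.toGen.reach (dictW R n₁)
  | .birth j cls zZ, Z, hRZ => exists_stopC_lt_reach hL hdrop hR hn₁ (.birth j cls zZ) Z hRZ
  | .renew G h, Z, hRZ => by
      obtain ⟨ZG, -, ht, h1, h2, -, rfl⟩ := hRZ
      refine ⟨R (h + 1), hR (h + 1), stopsC_renew_of_pair hL hdrop hR ht h1 h2, ?_⟩
      have h3 := restart_lt_dictW R n₁ (h + 1)
      simp only [PGen.lastStep, PGen.toGen, Gen.reach_renew]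
      omega
  | .join X Y sj, Z, hRZ => by
      obtain ⟨ZX, ZY, hX, hY, htX, htY, hpX, hpY, ⟨a, ha, c, hc, hac⟩, hZ⟩ := hRZ
      obtain ⟨kX, hkX1, hsX, hrX⟩ := exists_stopC_lt_reach_WH X ZX hX
      obtain ⟨kY, hkY1, hsY, hrY⟩ := exists_stopC_lt_reach_WH Y ZY hY
      set tX := X.lastStep
      set tY := Y.lastStep
      have hKX : sj - tX ≤ kX := by
        by_contra hlt; exact hpX.2 kX (by omega) hsX
      have hKY : sj - tY ≤ kY := by
        by_contra hlt; exact hpY.2 kY (by omega) hsY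
      have hXI : ∀ m, tX + kX - sj - 1 ≤ m →
          CondI 100 (Siter (ratio L fun i => s (sj + i)) m (orbit L s tX ZX (sj - tX))) := by
        intro m hm
        have h := condI_orbit_of_stopsC hL hdrop hR hsX ((sj - tX) + m) (by omega)
        rw [orbit_add, show tX + (sj - tX) = sj by omega] at h
        exact h
      have hYI : ∀ m, tY + kY - sj - 1 ≤ m →
          CondI 100 (Siter (ratio L fun i => s (sj + i)) m (orbit L s tY ZY (sj - tY))) := by
        intro m hm
        have h := condI_orbit_of_stopsC hL hdrop hR hsY ((sj - tY) + m) (by omega)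
        rw [orbit_add, show tY + (sj - tY) = sj by omega] at h
        exact h
      obtain ⟨k, hk1, hkle, hstop⟩ := stopAtC_join_hull (show 3 ≤ L by omega)
        (dropCtl_from hdrop sj (max (tX + kX - sj) (tY + kY - sj) + 13 + R sj)) ha hc hac
        (K₁ := tX + kX - sj) (K₂ := tY + kY - sj)
        (fun m hm => hXI m (by omega)) (fun m hm => hYI m (by omega)) (N := R sj) (fun _ => True)
        (fun _ _ _ => trivial) le_rfl
      refine ⟨k, hk1, ?_, ?_⟩
      · apply StopsC.subset hZ
        show StopAtC 100 (R sj) (fun _ => True)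
          (orbit L s sj (orbit L s tX ZX (sj - tX) ∪ orbit L s tY ZY (sj - tY))) k
        exact hstop
      · have h := join_lt_dictW R hn₁ sj (r₁ := X.toGen.reach (dictW R n₁)) (r₂ := Y.toGen.reach (dictW R n₁)) hkle
          (by omega) (by omega)
        simp only [PGen.lastStep, PGen.toGen, Gen.reach_merge]
        exact h

/-- **CHAIN-PENDING STRICTLY BEFORE THE CUTOFF ⇒ INSIDE THE BOOKED LIFE**, chain clock with hull contact. [folklore] -/
theorem lt_reach_of_pendingBeforeC_WH {P : PGen (Pt d × Finset (Pt d))} {Z : Finset (Pt d)}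
    (hP : RealisesCWH L s R P Z) {K : ℕ} (hK : PendingBeforeC L s R P.lastStep Z K) :
    K < P.toGen.reach (dictW R n₁) := by
  obtain ⟨k, -, hs, hlt⟩ := exists_stopC_lt_reach_WH hL hdrop hR hn₁ P Z hP
  have : K - P.lastStep ≤ k := by
    by_contra hlt'; exact hK.2 k (by omega) hs
  have := hK.1
  omega

/-- **`JoinInLife`, CHAIN CLOCK WITH HULL CONTACT.** [folklore] -/
theorem joinInLife_of_realisesCWH :
    ∀ (P : PGen (Pt d × Finset (Pt d))) (Z : Finset (Pt d)), RealisesCWH L s R P Z → P.JoinInLife (dictW R n₁)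
  | .birth _ _ _, _, _ => trivial
  | .renew G h, Z, hP => by
      obtain ⟨ZG, hG, -, -, -, -, -⟩ := hP
      exact joinInLife_of_realisesCWH G ZG hG
  | .join X Y sj, Z, hP => by
      obtain ⟨ZX, ZY, hX, hY, -, -, hpX, hpY, -, -⟩ := hP
      exact ⟨joinInLife_of_realisesCWH X ZX hX, joinInLife_of_realisesCWH Y ZY hY,
        lt_reach_of_pendingBeforeC_WH hL hdrop hR hn₁ hX hpX, lt_reach_of_pendingBeforeC_WH hL hdrop hR hn₁ hY hpY⟩

end MainC

/-- **`Adm`, CHAIN CLOCK WITH HULL CONTACT.** [folklore] -/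
theorem adm_of_realisesCWH {L : ℕ} {s R : ℕ → ℕ} :
    ∀ (P : PGen (Pt d × Finset (Pt d))) (Z : Finset (Pt d)), RealisesCWH L s R P Z →
      ∀ {K : ℕ}, P.lastStep ≤ K → P.Adm K
  | .birth _ _ _, _, _, _, hK => hK
  | .renew G h, Z, hP, K, hK => by
      obtain ⟨ZG, hG, ht, -, -, -, -⟩ := hP
      simp only [PGen.lastStep] at hK
      exact ⟨adm_of_realisesCWH G ZG hG (by omega), by omega, hK⟩
  | .join X Y sj, Z, hP, K, hK => by
      obtain ⟨ZX, ZY, hX, hY, htX, htY, -, -, -, -⟩ := hP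
      exact ⟨adm_of_realisesCWH X ZX hX (htX.trans hK), adm_of_realisesCWH Y ZY hY (htY.trans hK), htX, htY, hK⟩

/-! ## §3 Sanity -/

namespace Sanity

open B16MergeGeometry.OneDim

/-- the unit region is realised under both hull-contact predicates (births read no contact) [folklore] -/
theorem realisesWH_unit (L : ℕ) (s R : ℕ → ℕ) : RealisesWH L s R HistoryRealise.Sanity.unit {pt 0} :=
  realisesWH_of_realisesW _ _ (HistoryRealiseWeak.Sanity.realisesW_unit L s R)

/-- … chain clock [folklore] -/
theorem realisesCWH_unit (L : ℕ) (s R : ℕ → ℕ) : RealisesCWH L s R HistoryRealise.Sanity.unit {pt 0} :=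
  realisesCWH_of_realisesCW _ _ (HistoryReadinessChainRealiseWeak.Sanity.realisesCW_unit L s R)

/-- numeric instances of both main theorems' letters (`L = 13`, constant exponents, `R ≡ 2`, `n₁ = 13`). [folklore] -/
example : (∃ k, 1 ≤ k ∧ Stops 13 (fun _ => 0) (fun _ => 2) 0 ({pt 0} : Finset (Pt 1)) k ∧
      0 + k < (HistoryRealise.Sanity.unit).toGen.reach (dictW (fun _ => 2) 13)) ∧
    (∃ k, 1 ≤ k ∧ StopsC 13 (fun _ => 0) (fun _ => 2) 0 ({pt 0} : Finset (Pt 1)) k ∧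
      0 + k < (HistoryRealise.Sanity.unit).toGen.reach (dictW (fun _ => 2) 13)) :=
  ⟨exists_stop_lt_reach_WH (by norm_num) (fun m i k _ _ => by simp) (fun _ => by norm_num) le_rfl
      HistoryRealise.Sanity.unit {pt 0} (realisesWH_unit 13 _ _),
    exists_stopC_lt_reach_WH (by norm_num) (fun m i k _ _ => by simp) (fun _ => by norm_num) le_rfl
      HistoryRealise.Sanity.unit {pt 0} (realisesCWH_unit 13 _ _)⟩

/-- **A HULL-CONTACT JOIN THAT IS NOT A RAW CONTACT** (`d = 1`): the partners' images `{0, 4}` and `{2}` at the join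
scale do not touch (`pt 2` touches neither `pt 0` nor `pt 4`), but `pt 2` lies in the bounding box of `{0, 4}` — the
shape of contact the hull predicates admit and the raw ones do not. [folklore] -/
example : (pt 2 : Pt 1) ∈ bbox (↑({pt 0, pt 4} : Finset (Pt 1)) : Set (Pt 1)) ∧
    ¬ Touch (pt 0 : Pt 1) (pt 2) ∧ ¬ Touch (pt 4 : Pt 1) (pt 2) := by
  refine ⟨fun i => ⟨⟨pt 0, by simp, by simp [pt]⟩, ⟨pt 4, by simp, by simp [pt]⟩⟩, fun h => ?_, fun h => ?_⟩
  · have := (h 0).2; simp [pt] at this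
  · have := (h 0).1; simp [pt] at this

end Sanity

end

end Summit.QuantumFields.BalabanUV.T4Continuum.HistoryRealiseHull
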